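import Summits.Ventures.YMGap.RobustBall.TorusClusteringYM3
import Summits.Ventures.YMGap.RobustBall.TorusRowsSU2
import HarnessLib

/-!
# Venture YMGap, tracks Y2 → Y4 — `SU(2)`, `d = 3` ROWS of the receiving conjecture `YM3IR.ClusterDomainClustering`
(quarter one-link modulus; strong-coupling ceilings `β_W ∈ {1/8, 1/4, 3/10}`)

HONEST FRAMING. WHAT THIS IS: a venture file (cell `pub-ymgap`, seat ds-2): HYPOTHESIS-FREE instances of Y4's receiving
conjecture `YM3IR.ClusterDomainClustering B suFrobDist m` (`YM3IR/Clustering.lean`) for the concrete ball specs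
`B = ⟨fundamental SU(2), β⋆ = β_W/2, membership in ClusterDomainFR (2ε) ε r⟩` in `d = 3`, through the torus door of
`TorusClustering` / `TorusClusteringYM3` on the tree's QUARTER modulus (`OneLinkKRModulus 2 (3β_W/2) 1`, valid for
`β_W ≤ 2/3`; the `d = 3` radius `4β⋆/N = β_W ≤ 3β_W/2` is inside it). Wilson constant in `d = 3`:
`c_W = K (β⋆/N) 6(d−1) = 3β_W`; rows `rhoFR 2 (3β_W) (2ε) ε < 1` certified in the kernel by exact rationals
(`Real.exp_bound'`, `√2 ≤ 1.41422`): `(β_W, ε) = (1/8, 23/100)`, `(1/4, 3/50)`, `(3/10, 1/50)`. Each row: ONE constant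
`A = 16` such that every law `μ = W.perturbedMeasure (fundamentalRep (Fin 2)) β'`, `0 ≤ β' ≤ β_W/2`,
`W ∈ ClusterDomainFR (2ε) ε r`, on every torus `(ℤ/M)³`, `M ≥ 3`, clusters at rate `−log ρ/(r ⊔ 1) > 0`.
WHAT THIS IS NOT: these are STRONG-COUPLING ceilings (`β_W ≤ 3/10`); Y4's infrared theorem needs the ball to be ENTERED
by Bałaban's effective actions at a `β⋆` of its choosing — nothing here says that happens; no continuum statement, no
Millennium claim.

## References
* The tree: `YM3IR/Clustering.lean` (`ClusterDomainClustering`), `RobustBall/TorusClusteringYM3.lean`,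
  `RobustBall/TorusRowsSU2.lean` (numerical majorants), `Thresholds/QuarterModulusTwoThirds.lean` (the modulus).
-/

noncomputable section

open MeasureTheory ProbabilityTheory Finset Function Real
open Literature.Probability.LatticeModels Literature.Probability.LatticeModels.DobrushinMetric
open Literature.MathematicalPhysics.QuantumLattice hiding torusNorm
open Literature.MathematicalPhysics.QuantumFieldTheory hiding ZdEdge
open Literature.MathematicalPhysics.QuantumFieldTheory.Balaban1983to89.StrongCouplingDobrushinWindow
  (OneLinkKRModulus OneLinkKRModulusSU2)

namespace Summit.Ventures.YMGap.RobustBall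

/-! ### Numerical bounds and the certified `d = 3` rows -/

/-- `e^{3/25} ≤ 1.127497`. [folklore] -/
theorem exp_012_le : Real.exp (3 / 25) ≤ 1.127497 := by
  have h := Real.exp_bound' (x := 3 / 25) (by norm_num) (by norm_num) (n := 5) (by norm_num)
  refine h.trans ?_
  simp only [Finset.sum_range_succ, Finset.sum_range_zero, Nat.factorial]
  norm_num

/-- `e^{1/25} ≤ 1.040811`. [folklore] -/
theorem exp_004_le : Real.exp (1 / 25) ≤ 1.040811 := by
  have h := Real.exp_bound' (x := 1 / 25) (by norm_num) (by norm_num) (n := 5) (by norm_num)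
  refine h.trans ?_
  simp only [Finset.sum_range_succ, Finset.sum_range_zero, Nat.factorial]
  norm_num

/-- `d = 3` row `(β_W, ε) = (1/8, 23/100)`: `rhoFR 2 (3/8) (23/50) (23/100) < 1` (`≈ 0.980`). [folklore] -/
theorem rhoFR_su2_dim3_oneEighth_lt_one : rhoFR 2 (3 / 8) (23 / 50) (23 / 100) < 1 := by
  refine lt_of_le_of_lt (rhoFR_le_of_bounds (by norm_num) (by norm_num) exp_046_le sqrt_two_le) ?_
  norm_num

/-- `d = 3` row `(β_W, ε) = (1/4, 3/50)`: `rhoFR 2 (3/4) (3/25) (3/50) < 1` (`≈ 0.989`). [folklore] -/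
theorem rhoFR_su2_dim3_oneQuarter_lt_one : rhoFR 2 (3 / 4) (3 / 25) (3 / 50) < 1 := by
  refine lt_of_le_of_lt (rhoFR_le_of_bounds (by norm_num) (by norm_num) exp_012_le sqrt_two_le) ?_
  norm_num

/-- `d = 3` row `(β_W, ε) = (3/10, 1/50)`: `rhoFR 2 (9/10) (1/25) (1/50) < 1` (`≈ 0.990`). [folklore] -/
theorem rhoFR_su2_dim3_threeTenths_lt_one : rhoFR 2 (9 / 10) (1 / 25) (1 / 50) < 1 := by
  refine lt_of_le_of_lt (rhoFR_le_of_bounds (by norm_num) (by norm_num) exp_004_le sqrt_two_le) ?_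
  norm_num

/-! ### The `SU(2)`, `d = 3` receiving conjecture on the quarter modulus -/

/-- **`SU(2)`, `d = 3`: Y4's receiving conjecture on the quarter modulus.** For `0 < β_W ≤ 2/3`, `ε₀, ε₁ ≥ 0` and a
certified row `rhoFR 2 (3β_W) ε₀ ε₁ < 1`: `ClusterDomainClustering ⟨fundamental, β_W/2, ClusterDomainFR ε₀ ε₁ r⟩
suFrobDist (−log ρ/(r ⊔ 1))`. [folklore] -/
theorem su2_clusterDomainClustering_quarter {βW ε₀ ε₁ : ℝ} (hβ0 : 0 < βW) (hβ : βW ≤ 2 / 3) (hε₀ : 0 ≤ ε₀)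
    (hε₁ : 0 ≤ ε₁) (r : ℕ) (hρ1 : rhoFR 2 (3 * βW) ε₀ ε₁ < 1) :
    YM3IR.ClusterDomainClustering (G := SUN 2)
      ⟨fundamentalRep (Fin 2), βW / 2, fun _ _ W => W ∈ ClusterDomainFR ε₀ ε₁ r⟩ suFrobDist
      (-Real.log (rhoFR 2 (3 * βW) ε₀ ε₁) / max r 1) := by
  have hmod : OneLinkKRModulus 2 (3 * βW / 2) 1 := by
    have h := QuarterModulusTwoThirds.oneLinkKRModulusSU2_of_le_twoThirds hβ
    unfold OneLinkKRModulusSU2 at h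
    norm_num at h
    exact h
  have hR : βW / 2 / ((2 : ℕ) : ℝ) * 4 ≤ 3 * βW / 2 := by push_cast; linarith
  have hcW : (1 : ℝ) * (βW / 2 / ((2 : ℕ) : ℝ)) * 12 = 3 * βW := by push_cast; ring
  have hρ0 : 0 < rhoFR 2 (3 * βW) ε₀ ε₁ := rhoFR_pos (by positivity) hε₁
  have h := clusterDomainClustering_of_oneLinkKRModulus (N := 2) (by norm_num) (βs := βW / 2) zero_le_one hR hmod
    hε₀ hε₁ r (by rw [hcW]; exact hρ0) (by rw [hcW]; exact hρ1)
  rw [hcW] at h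
  exact h

/-- **ROW `d = 3`, `(β_W, ε) = (1/8, 23/100)`**: `ClusterDomainClustering ⟨fundamental SU(2), 1/16,
ClusterDomainFR (23/50) (23/100) r⟩ suFrobDist (−log(rhoFR 2 (3/8) (23/50) (23/100))/(r ⊔ 1))`; HYPOTHESIS-FREE. [folklore] -/
theorem su2_clusterDomainClustering_dim3_oneEighth (r : ℕ) :
    YM3IR.ClusterDomainClustering (G := SUN 2)
      ⟨fundamentalRep (Fin 2), 1 / 16, fun _ _ W => W ∈ ClusterDomainFR (23 / 50) (23 / 100) r⟩ suFrobDist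
      (-Real.log (rhoFR 2 (3 / 8) (23 / 50) (23 / 100)) / max r 1) := by
  have e1 : (1 : ℝ) / 8 / 2 = 1 / 16 := by norm_num
  have e2 : (3 : ℝ) * (1 / 8) = 3 / 8 := by norm_num
  have h := su2_clusterDomainClustering_quarter (βW := 1 / 8) (ε₀ := 23 / 50) (ε₁ := 23 / 100) (by norm_num)
    (by norm_num) (by norm_num) (by norm_num) r (by rw [e2]; exact rhoFR_su2_dim3_oneEighth_lt_one)
  rw [e1, e2] at h
  exact h

/-- **ROW `d = 3`, `(β_W, ε) = (1/4, 3/50)`** (ceiling `β⋆ = 1/8` in tree units); HYPOTHESIS-FREE. [folklore] -/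
theorem su2_clusterDomainClustering_dim3_oneQuarter (r : ℕ) :
    YM3IR.ClusterDomainClustering (G := SUN 2)
      ⟨fundamentalRep (Fin 2), 1 / 8, fun _ _ W => W ∈ ClusterDomainFR (3 / 25) (3 / 50) r⟩ suFrobDist
      (-Real.log (rhoFR 2 (3 / 4) (3 / 25) (3 / 50)) / max r 1) := by
  have e1 : (1 : ℝ) / 4 / 2 = 1 / 8 := by norm_num
  have e2 : (3 : ℝ) * (1 / 4) = 3 / 4 := by norm_num
  have h := su2_clusterDomainClustering_quarter (βW := 1 / 4) (ε₀ := 3 / 25) (ε₁ := 3 / 50) (by norm_num)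
    (by norm_num) (by norm_num) (by norm_num) r (by rw [e2]; exact rhoFR_su2_dim3_oneQuarter_lt_one)
  rw [e1, e2] at h
  exact h

/-- **ROW `d = 3`, `(β_W, ε) = (3/10, 1/50)`** (ceiling `β⋆ = 3/20` in tree units); HYPOTHESIS-FREE. [folklore] -/
theorem su2_clusterDomainClustering_dim3_threeTenths (r : ℕ) :
    YM3IR.ClusterDomainClustering (G := SUN 2)
      ⟨fundamentalRep (Fin 2), 3 / 20, fun _ _ W => W ∈ ClusterDomainFR (1 / 25) (1 / 50) r⟩ suFrobDist
      (-Real.log (rhoFR 2 (9 / 10) (1 / 25) (1 / 50)) / max r 1) := by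
  have e1 : (3 : ℝ) / 10 / 2 = 3 / 20 := by norm_num
  have e2 : (3 : ℝ) * (3 / 10) = 9 / 10 := by norm_num
  have h := su2_clusterDomainClustering_quarter (βW := 3 / 10) (ε₀ := 1 / 25) (ε₁ := 1 / 50) (by norm_num)
    (by norm_num) (by norm_num) (by norm_num) r (by rw [e2]; exact rhoFR_su2_dim3_threeTenths_lt_one)
  rw [e1, e2] at h
  exact h

/-- The rate of the `d = 3` row `(1/8, 23/100)` is positive. [folklore] -/
theorem su2_dim3_oneEighth_rate_pos (r : ℕ) :
    0 < -Real.log (rhoFR 2 (3 / 8) (23 / 50) (23 / 100)) / max (r : ℝ) 1 := by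
  have hρ0 : 0 < rhoFR 2 (3 / 8) (23 / 50) (23 / 100) := rhoFR_pos (by norm_num) (by norm_num)
  exact div_pos (neg_pos.2 (Real.log_neg hρ0 rhoFR_su2_dim3_oneEighth_lt_one)) (lt_max_of_lt_right one_pos)

end Summit.Ventures.YMGap.RobustBall

end
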